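import Summits.BirchSwinnertonDyer.BirchSwinnertonDyer.Theorems.ManinLocalTwoThreeTwistDefectFamilies

/-!
# THE DEFECT LAW OF THE TWIST GROUPOID, part 3 of 4: the defect law from a `q`-EXPANSION IDENTITY — no isogeny, no local hypothesis
(cell bsd-f2-manin, desc g46 MEMO-desc §71 §6, E-desc-239/240, TURNKEY T-desc-58; landed by p1 gen 25)

`aₙ(D'.f) = χ(n)·aₙ(D_A.f)` replaces the isogeny `W' ∼ A ⊗ d` and the additivity binders: `maninConstant_dvd_mul_of_additiveTwist_of_cuspCoeff_level`,
`abs_maninConstant_eq_one_of_twoTwist_cuspCoeff_aligned`, `maninConstant_dvd_defect_of_oddTwist_cuspCoeff`, Props `TwoTwistCuspCoeffManinDvd`,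
`OddTwistCuspCoeffManinDvd` (implied by `LevelManinOne`), `twistCuspCoeff_families`.  No named fact; C2, C3, Manin's conjecture and BSD NOT proved.
[cite: Stevens1989, Lemma (5.2) p. 96, Lemma (5.4) p. 97, (5.6)–(5.7) p. 98] [cite: Pal2012, Prop. 2.4, Lemma 3.1]
[cite: Connell1999, §5.7.3] [cite: SilvermanAEC2009, Cor. VII.7.2, §C.16] [cite: SilvermanATAEC1994, Cor. IV.9.1] [cite: EdixhovenManin1991, Prop. 2]
-/

set_option autoImplicit false
-- the summit-side namespace `Summit.BirchSwinnertonDyer.BirchSwinnertonDyer.…` is the tree's (summit = sub-problem)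
set_option linter.dupNamespace false

noncomputable section

open scoped Classical NumberField MatrixGroups ModularForm

namespace Summit.BirchSwinnertonDyer.BirchSwinnertonDyer.Theorems.ManinLocalTwoThree.TwistDefect

open WeierstrassCurve CongruenceSubgroup IsDedekindDomain IsDedekindDomain.HeightOneSpectrum Rat.HeightOneSpectrum
  Literature.NumberTheory.Automorphic Literature.NumberTheory.EllipticCurves Literature.NumberTheory.EllipticCurves.ModularForms
  Literature.NumberTheory.LFunctions.PrimitiveQuadratic Summit.BirchSwinnertonDyer.BirchSwinnertonDyer.Theorems
  Summit.BirchSwinnertonDyer.BirchSwinnertonDyer.Theorems.ManinLocalTwoThree Summit.BirchSwinnertonDyer.Rank1Residual.ManinAdditive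
  Summit.BirchSwinnertonDyer.BirchSwinnertonDyer.Theorems.ManinLocalTwoThree.TwistFamilies
  Summit.BirchSwinnertonDyer.BirchSwinnertonDyer.Theorems.ManinLocalTwoThree.AdditiveTwistFamilies

/-! ## §6 THE DEFECT LAW FROM A `q`-EXPANSION IDENTITY — no isogeny, no local hypothesis (E-desc-239/240)

The engines of §1–§5 take the member as a curve `W' ∼ A ⊗ d` (an ISOGENY hypothesis `htw`), which
is used ONLY to derive the coefficient identity `aₙ(f_{D'}) = χ(n)·aₙ(f_{D_A})`.  For a class whose
optimal curve is not reached by an explicit parametrisation (p3: `128b`, `128d`, "y not an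
η-quotient") the natural certificate is that identity itself — a statement about two FORMS of level
`N`, checkable on finitely many coefficients in an explicit basis of `S₂(Γ₀(N))` — and NOT an isogeny
(which, read off `L`-functions, would cost Faltings = the named fact
`isIsogenous_iff_frobeniusTrace_eq`).  71.F/71.G below re-cut p2's level-free engine and the odd
engine with the identity `hf` as the hypothesis: inputs = a datum `D_A` on the root with `|c(D_A)| = 1`,
a minimal model `C` of `A ⊗ d` with its defect `r`, the levels, `hf`, lattice-optimality of `D'`.
Output `c(D') ∣ r`.  No isogeny, no reduction-type hypothesis (the latter by §5's `additive_of_sq_dvd_level`). -/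

/-- **71.F-engine (p2's `…additiveTwist_of_char_level` with the `q`-expansion identity as INPUT).**
Verbatim the landed level-free dyadic engine, except that the isogeny `W ∼ A ⊗ d` and the relation
`aₙ(A ⊗ d) = χ(n)aₙ(A)` are replaced by the single hypothesis
`hf : aₙ(f_D) = χ(n)·aₙ(f_{D'})` at ODD `n` (at even `n` both sides vanish: `W`, `A` additive at `2`).
[cite: Stevens1989, Lemma (5.4) p. 97] [cite: Pal2012, Lemma 3.1] -/
theorem maninConstant_dvd_mul_of_additiveTwist_of_cuspCoeff_level
    {W : WeierstrassCurve ℚ} [W.IsElliptic] [W.IsGloballyMinimal] {N : ℕ} [NeZero N]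
    (D : ModularParametrizationData W N)
    (hopt : ∀ z ∈ D.L.lattice, ∃ w ∈ periodLattice D.f, z = D.c * w)
    {A : WeierstrassCurve ℚ} [A.IsElliptic] [A.IsGloballyMinimal] {N' : ℕ} [NeZero N']
    (D' : ModularParametrizationData A N')
    {d : ℤ} (hd : d ≠ 0)
    {m : ℕ} [NeZero m] {χ : DirichletCharacter ℂ m} (hχq : χ.IsQuadratic) (hχp : χ.IsPrimitive)
    (hG : gaussSum χ (ZMod.stdAddChar (N := m)) ^ 2 = ((4 * d : ℤ) : ℂ))
    (hsumOf : (∀ x : ℚ, modularSymbol D'.f (x + 1 / 2) = -modularSymbol D'.f x) →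
      ∀ x : ℚ, ∃ (u₁ u₂ : ZMod m) (ε : ℤ),
        ∑ v : ZMod m, χ v * modularSymbol D'.f (x + twistShift v) =
          2 * (modularSymbol D'.f (x + twistShift u₁) + ε * modularSymbol D'.f (x + twistShift u₂)))
    (hχeven : ∀ n : ℕ, 2 ∣ n → χ n = 0)
    (hf : ∀ n : ℕ, ¬ 2 ∣ n → cuspCoeff D.f n = χ n * cuspCoeff D'.f n)
    {C : WeierstrassCurve ℚ} [C.IsElliptic] [C.IsGloballyMinimal] (u : VariableChange ℚ)
    (hu : u • A.quadraticTwist (d : ℚ) = C) {r : ℤ} (hΔ : (r : ℚ) ^ 12 * C.Δ = (d : ℚ) ^ 6 * A.Δ)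
    {L : ℕ} [NeZero L] (hNL : N ∣ L) (k : ℕ) (hLN : L ∣ N ^ (k + 1)) (hN'L : N' ∣ L) (hmL : m ^ 2 ∣ L)
    (h4N' : 4 ∣ N')
    (haddA : ¬ A.HasGoodReductionAtPrime 2 ∧ ¬ A.HasMultiplicativeReductionAtPrime 2)
    (hadd : ¬ W.HasGoodReductionAtPrime 2 ∧ ¬ W.HasMultiplicativeReductionAtPrime 2) :
    D.c ∣ r * D'.c := by
  have hd0 : (d : ℚ) ≠ 0 := by exact_mod_cast hd
  haveI : (A.quadraticTwist (d : ℚ)).IsElliptic := A.isElliptic_quadraticTwist hd0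
  set s : ℂ := gaussSum χ (ZMod.stdAddChar (N := m)) / 2 with hs
  have hG0 : gaussSum χ (ZMod.stdAddChar (N := m)) ≠ 0 :=
    gaussSum_stdAddChar_ne_zero_of_isPrimitive hχp
  have hs2 : s ^ 2 = ((d : ℚ) : ℂ) := by
    rw [hs, div_pow, hG]
    push_cast
    ring
  -- HALF-TRANSLATE for `f_{D'}`: the even coefficients of the newform of `A` vanish (`A` additive at `2`)
  have heven : ∀ n : ℕ, 2 ∣ n → cuspCoeff D'.f n = 0 := by
    intro n hn
    rw [D'.isNewformOf.2 n, A.LFunction_apply_eq_zero_of_not_good_of_not_mult 2 haddA.1 haddA.2 hn]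
    simp
  have hhalf : ∀ x : ℚ, modularSymbol D'.f (x + 1 / 2) = -modularSymbol D'.f x :=
    maninLocalTwoThree_modularSymbol_add_half_eq_neg_of_four_dvd D'.f h4N' heven
  -- the exact twist step `s · Λ(f_{D'} ⊗ χ) ⊆ Λ(f_{D'})`, the twist read at level `L`
  have hstep : ∀ w ∈ periodLattice (charTwist L hN'L hmL hχq D'.f), s * w ∈ periodLattice D'.f :=
    fun w hw ↦ half_gaussSum_mul_mem_periodLattice_of_mem_charTwist L hN'L hmL hχq hχp D'.f
      (hsumOf hhalf) hw
  -- the `q`-expansion identity at ALL `n`: odd `n` by hypothesis, even `n` both sides vanish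
  have hf' : ∀ n : ℕ, cuspCoeff D.f n = χ n * cuspCoeff D'.f n := by
    intro n
    by_cases h2n : 2 ∣ n
    · rw [D.isNewformOf.2 n, W.LFunction_apply_eq_zero_of_not_good_of_not_mult 2 hadd.1 hadd.2 h2n,
        hχeven n h2n]
      simp
    · exact hf n h2n
  -- at level `L`: the lift `ι₁ f_D` IS `f_{D'} ⊗ χ`, and `Λ(ι₁ f_D) = Λ(f_D)`
  have hlift : degeneracyMap0 N L 1 2 D.f = charTwist L hN'L hmL hχq D'.f :=
    eq_of_forall_cuspCoeff_eq_gamma0 fun n ↦ by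
      rw [maninLocalTwoThree_cuspCoeff_degeneracyMap0_one D.f hNL, hf', cuspCoeff_charTwist L hN'L hmL hχq hχp]
  have hle : periodLattice D.f ≤ periodLattice (charTwist L hN'L hmL hχq D'.f) := by
    rw [← hlift, maninLocalTwoThree_periodLattice_degeneracyMap0_one D.f hNL k hLN]
  -- Néron lattice of the minimal model `C` of `A ⊗ d`: `z ∈ Λ_C ↔ s r⁻¹ z ∈ Λ_A`
  obtain ⟨LC, hC⟩ := exists_isNeronLatticeOf_holds (C.baseChange ℂ)
  have hLC : ∀ z : ℂ, s * z ∈ D'.L.lattice → (r : ℂ) * z ∈ LC.lattice := by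
    intro z hz
    rw [neronLattice_mem_iff_of_twist_of_sq_eq hd0 u hu hΔ hs2 D'.isNeronLattice hC]
    by_cases hr : (r : ℚ) = 0
    · have : ((r : ℚ) : ℂ) = 0 := by exact_mod_cast hr
      rw [show (r : ℂ) = ((r : ℚ) : ℂ) by push_cast; rfl, this, zero_mul, mul_zero, mul_zero]
      exact zero_mem _
    · have hrC : ((r : ℚ) : ℂ) ≠ 0 := by exact_mod_cast hr
      have e : s * ((((r : ℚ) : ℂ))⁻¹ * ((r : ℂ) * z)) = s * z := by
        rw [show (r : ℂ) = ((r : ℚ) : ℂ) by push_cast; rfl]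
        field_simp
      rw [e]
      exact hz
  exact maninLocalTwoThree_maninConstant_dvd_mul_of_twistStep_of_le D' D hopt hχq hN'L hmL hle s hstep hC r
    hLC

/-- **71.F  THE DYADIC DEFECT LAW FROM THE IDENTITY `f_{D'} = f_{D_A} ⊗ χ_{±8}` (odd coefficients),
LEVEL-FREE, NO ISOGENY, NO LOCAL HYPOTHESIS.**  Root `A` globally minimal with an `X₀(M)`-datum `D_A`,
`4 ∣ M`; `C = u • (A ⊗ d)` globally minimal, `d = ±2`, defect `r`; member `W'` globally minimal with a
lattice-optimal `X₀(N)`-datum `D'`, `4 ∣ N`, `M ∣ 2⁶N`, and `aₙ(f_{D'}) = χ_d(n)·aₙ(f_{D_A})` at odd `n`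
(`χ_2 = χ₈`, `χ_{-2} = χ₈'`).  Then `c(D') ∣ r·c(D_A)`.  Additivity of `A`, `W'` at `2` is DERIVED
(`additive_of_sq_dvd_level`). [cite: Stevens1989, Lemma (5.4) p. 97] [cite: Pal2012, Prop. 2.4, Lemma 3.1] -/
theorem maninConstant_dvd_mul_of_twoTwist_cuspCoeff {d : ℤ} (hd : d = 2 ∨ d = -2)
    {A : WeierstrassCurve ℚ} [A.IsElliptic] [A.IsGloballyMinimal] {M : ℕ} [NeZero M]
    (DA : ModularParametrizationData A M) (h4M : 4 ∣ M)
    {C : WeierstrassCurve ℚ} [C.IsElliptic] [C.IsGloballyMinimal] (u : VariableChange ℚ)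
    (hu : u • A.quadraticTwist (d : ℚ) = C) {r : ℤ} (hΔ : (r : ℚ) ^ 12 * C.Δ = (d : ℚ) ^ 6 * A.Δ)
    {W' : WeierstrassCurve ℚ} [W'.IsElliptic] [W'.IsGloballyMinimal] {N : ℕ} [NeZero N]
    (D' : ModularParametrizationData W' N) (h4N : 2 ^ 2 ∣ N) (hML : M ∣ 2 ^ 6 * N)
    (hf : ∀ n : ℕ, ¬ 2 ∣ n →
      cuspCoeff D'.f n = ((if d = 2 then ZMod.χ₈ n else ZMod.χ₈' n : ℤ) : ℂ) * cuspCoeff DA.f n)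
    (hopt' : ∀ z ∈ D'.L.lattice, ∃ w ∈ periodLattice D'.f, z = D'.c * w) :
    D'.c ∣ r * DA.c := by
  haveI : Fact (Nat.Prime 2) := ⟨Nat.prime_two⟩
  haveI : NeZero (2 ^ 6 * N) := ⟨mul_ne_zero (by norm_num) (NeZero.ne N)⟩
  have haddA : ¬ A.HasGoodReductionAtPrime 2 ∧ ¬ A.HasMultiplicativeReductionAtPrime 2 :=
    KatoCurve.additive_of_sq_dvd_level 2 A DA.f DA.isNewformOf
      (by rw [show (2 : ℕ) ^ 2 = 4 by norm_num]; exact h4M)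
  have hadd' : ¬ W'.HasGoodReductionAtPrime 2 ∧ ¬ W'.HasMultiplicativeReductionAtPrime 2 :=
    KatoCurve.additive_of_sq_dvd_level 2 W' D'.f D'.isNewformOf h4N
  have hdZ : d ≠ 0 := by rcases hd with rfl | rfl <;> norm_num
  have hNL : N ∣ 2 ^ 6 * N := dvd_mul_left N _
  have hLN : 2 ^ 6 * N ∣ N ^ (3 + 1) := maninLocalTwoThree_two_pow_six_mul_dvd_pow_four h4N
  have hmL : 8 ^ 2 ∣ 2 ^ 6 * N := ⟨N, by norm_num⟩
  rcases hd with rfl | rfl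
  · exact maninConstant_dvd_mul_of_additiveTwist_of_cuspCoeff_level D' hopt' DA hdZ
      isQuadratic_χ₈_ringHomComp isPrimitive_χ₈_ringHomComp
      (by rw [gaussSum_χ₈_ringHomComp_sq]; norm_num)
      (fun hhalf x ↦ ⟨1, 3, -1, sum_χ₈_modularSymbol_of_half DA.f hhalf x⟩)
      (fun n hn ↦ by
        rw [χ₈_ringHomComp_apply_natCast, ZMod.χ₈_nat_eq_if_mod_eight,
          if_pos (Nat.mod_eq_zero_of_dvd hn)]
        simp)
      (fun n hn ↦ by rw [χ₈_ringHomComp_apply_natCast, hf n hn, if_pos rfl])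
      u hu hΔ hNL 3 hLN hML hmL h4M haddA hadd'
  · exact maninConstant_dvd_mul_of_additiveTwist_of_cuspCoeff_level D' hopt' DA hdZ
      isQuadratic_χ₈'_ringHomComp isPrimitive_χ₈'_ringHomComp
      (by rw [gaussSum_χ₈'_ringHomComp_sq]; norm_num)
      (fun hhalf x ↦ ⟨1, 3, 1, sum_χ₈'_modularSymbol_of_half DA.f hhalf x⟩)
      (fun n hn ↦ by
        rw [χ₈'_ringHomComp_apply_natCast, ZMod.χ₈'_nat_eq_if_mod_eight,
          if_pos (Nat.mod_eq_zero_of_dvd hn)]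
        simp)
      (fun n hn ↦ by rw [χ₈'_ringHomComp_apply_natCast, hf n hn, if_neg (by norm_num)])
      u hu hΔ hNL 3 hLN hML hmL h4M haddA hadd'

/-- **71.F for a CERTIFIED ROOT DATUM: `c(D') ∣ r`** (`|c(D_A)| = 1` — e.g. p3's
`abs_maninConstant_eq_one_oneTwentyEightA/C_of_f_eq` for the EXO datum of `φ₁₂₈a/c`, or `LevelManinOne M`). -/
theorem maninConstant_dvd_defect_of_twoTwist_cuspCoeff {d : ℤ} (hd : d = 2 ∨ d = -2)
    {A : WeierstrassCurve ℚ} [A.IsElliptic] [A.IsGloballyMinimal] {M : ℕ} [NeZero M]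
    (DA : ModularParametrizationData A M) (hDA : |DA.maninConstant| = 1) (h4M : 4 ∣ M)
    {C : WeierstrassCurve ℚ} [C.IsElliptic] [C.IsGloballyMinimal] (u : VariableChange ℚ)
    (hu : u • A.quadraticTwist (d : ℚ) = C) {r : ℤ} (hΔ : (r : ℚ) ^ 12 * C.Δ = (d : ℚ) ^ 6 * A.Δ)
    {W' : WeierstrassCurve ℚ} [W'.IsElliptic] [W'.IsGloballyMinimal] {N : ℕ} [NeZero N]
    (D' : ModularParametrizationData W' N) (h4N : 2 ^ 2 ∣ N) (hML : M ∣ 2 ^ 6 * N)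
    (hf : ∀ n : ℕ, ¬ 2 ∣ n →
      cuspCoeff D'.f n = ((if d = 2 then ZMod.χ₈ n else ZMod.χ₈' n : ℤ) : ℂ) * cuspCoeff DA.f n)
    (hopt' : ∀ z ∈ D'.L.lattice, ∃ w ∈ periodLattice D'.f, z = D'.c * w) :
    D'.maninConstant ∣ r :=
  dvd_of_dvd_mul_of_abs_eq_one
    (maninConstant_dvd_mul_of_twoTwist_cuspCoeff hd DA h4M u hu hΔ D' h4N hML hf hopt') hDA

/-- **71.F, ALIGNED (`r = ±1`): `|c(D')| = 1`** — the statement p3 needs for `128b = 128a ⊗ χ₋₈`,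
`128d = 128a ⊗ χ₈` (and `128b/128d` from `128c`): per lattice-optimal datum `D'` whose FORM is the
`χ_{±8}`-twist of a certified root's form, with an explicit aligned minimal model of `A ⊗ d`. -/
theorem abs_maninConstant_eq_one_of_twoTwist_cuspCoeff_aligned {d : ℤ} (hd : d = 2 ∨ d = -2)
    {A : WeierstrassCurve ℚ} [A.IsElliptic] [A.IsGloballyMinimal] {M : ℕ} [NeZero M]
    (DA : ModularParametrizationData A M) (hDA : |DA.maninConstant| = 1) (h4M : 4 ∣ M)
    {C : WeierstrassCurve ℚ} [C.IsElliptic] [C.IsGloballyMinimal] (u : VariableChange ℚ)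
    (hu : u • A.quadraticTwist (d : ℚ) = C) {r : ℤ} (hr : r = 1 ∨ r = -1)
    (hΔ : (r : ℚ) ^ 12 * C.Δ = (d : ℚ) ^ 6 * A.Δ)
    {W' : WeierstrassCurve ℚ} [W'.IsElliptic] [W'.IsGloballyMinimal] {N : ℕ} [NeZero N]
    (D' : ModularParametrizationData W' N) (h4N : 2 ^ 2 ∣ N) (hML : M ∣ 2 ^ 6 * N)
    (hf : ∀ n : ℕ, ¬ 2 ∣ n →
      cuspCoeff D'.f n = ((if d = 2 then ZMod.χ₈ n else ZMod.χ₈' n : ℤ) : ℂ) * cuspCoeff DA.f n)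
    (hopt' : ∀ z ∈ D'.L.lattice, ∃ w ∈ periodLattice D'.f, z = D'.c * w) :
    |D'.maninConstant| = 1 := by
  have h := maninConstant_dvd_defect_of_twoTwist_cuspCoeff hd DA hDA h4M u hu hΔ D' h4N hML hf hopt'
  rcases hr with rfl | rfl
  · exact Int.isUnit_iff_abs_eq.mp (isUnit_of_dvd_one h)
  · exact Int.isUnit_iff_abs_eq.mp (isUnit_of_dvd_one (dvd_neg.mp h))

/-- **71.G-engine  THE ODD DEFECT LAW FROM THE IDENTITY `f_D = f_{D'} ⊗ χ_{q*}` (all coefficients),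
NO ISOGENY, NO LOCAL HYPOTHESIS.**  71.A with the isogeny `C ∼ W` and the additivity of `W` at `q`
replaced by the `q`-expansion identity (the only use they had). [cite: Stevens1989, Lemma (5.4) p. 97]
[cite: Pal2012, Lemma 3.1, Prop. 2.5] -/
theorem maninConstant_dvd_mul_of_oddTwist_cuspCoeff
    {q : ℕ} [Fact q.Prime] (hq2 : q ≠ 2)
    {W : WeierstrassCurve ℚ} [W.IsElliptic] [W.IsGloballyMinimal] {N : ℕ} [NeZero N]
    (D : ModularParametrizationData W N)
    (hopt : ∀ z ∈ D.L.lattice, ∃ w ∈ periodLattice D.f, z = D.c * w)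
    {A : WeierstrassCurve ℚ} [A.IsElliptic] {N' : ℕ} [NeZero N'] (D' : ModularParametrizationData A N')
    (hN'N : N' ∣ N) (hqN : q ^ 2 ∣ N)
    (hf : ∀ n : ℕ, cuspCoeff D.f n =
      (quadraticChar (ZMod q)).ringHomComp (Int.castRingHom ℂ) n * cuspCoeff D'.f n)
    {C : WeierstrassCurve ℚ} [C.IsElliptic] [C.IsGloballyMinimal] (u : VariableChange ℚ)
    (hu : u • A.quadraticTwist (((-1 : ℤ) ^ (q / 2) * q : ℤ) : ℚ) = C)
    {r : ℤ} (hr : r ≠ 0)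
    (hΔ : (r : ℚ) ^ 12 * C.Δ = ((((-1 : ℤ) ^ (q / 2) * q : ℤ)) : ℚ) ^ 6 * A.Δ) :
    D.c ∣ r * D'.c := by
  have hq : q.Prime := Fact.out
  haveI : NeZero q := ⟨hq.ne_zero⟩
  obtain ⟨LC, hLC⟩ := exists_isNeronLatticeOf_holds (C.baseChange ℂ)
  have hrC : ((r : ℚ) : ℂ) ≠ 0 := by exact_mod_cast hr
  have hmem : ∀ z : ℂ,
      gaussSum ((quadraticChar (ZMod q)).ringHomComp (Int.castRingHom ℂ))
        (ZMod.stdAddChar (N := q)) * z ∈ D'.L.lattice → (r : ℂ) * z ∈ LC.lattice := by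
    intro z hz
    rw [neronLattice_mem_iff_of_twist_pStar hq2 u hu hΔ D'.isNeronLattice hLC]
    have e : ((((r : ℚ) : ℂ))⁻¹ * ((r : ℂ) * z)) = z := by
      rw [show (r : ℂ) = ((r : ℚ) : ℂ) by push_cast; rfl, ← mul_assoc, inv_mul_cancel₀ hrC, one_mul]
    rw [e]
    exact hz
  exact maninConstant_dvd_mul_of_charTwist_gamma0 D' D hopt (isQuadratic_quadraticChar_ringHomComp q)
    (isPrimitive_quadraticChar_ringHomComp q hq2) hN'N hqN hf hLC r hmem

/-- **71.G for a CERTIFIED ROOT DATUM: `c(D') ∣ r`.** -/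
theorem maninConstant_dvd_defect_of_oddTwist_cuspCoeff {q : ℕ} [Fact q.Prime] (hq2 : q ≠ 2)
    {A : WeierstrassCurve ℚ} [A.IsElliptic] {M : ℕ} [NeZero M]
    (DA : ModularParametrizationData A M) (hDA : |DA.maninConstant| = 1)
    {C : WeierstrassCurve ℚ} [C.IsElliptic] [C.IsGloballyMinimal] (u : VariableChange ℚ)
    (hu : u • A.quadraticTwist (((-1 : ℤ) ^ (q / 2) * q : ℤ) : ℚ) = C)
    {r : ℤ} (hr : r ≠ 0) (hΔ : (r : ℚ) ^ 12 * C.Δ = ((((-1 : ℤ) ^ (q / 2) * q : ℤ)) : ℚ) ^ 6 * A.Δ)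
    {W' : WeierstrassCurve ℚ} [W'.IsElliptic] [W'.IsGloballyMinimal] {N : ℕ} [NeZero N]
    (D' : ModularParametrizationData W' N) (hMN : M ∣ N) (hqN : q ^ 2 ∣ N)
    (hf : ∀ n : ℕ, cuspCoeff D'.f n =
      (quadraticChar (ZMod q)).ringHomComp (Int.castRingHom ℂ) n * cuspCoeff DA.f n)
    (hopt' : ∀ z ∈ D'.L.lattice, ∃ w ∈ periodLattice D'.f, z = D'.c * w) :
    D'.maninConstant ∣ r :=
  dvd_of_dvd_mul_of_abs_eq_one
    (maninConstant_dvd_mul_of_oddTwist_cuspCoeff hq2 D' hopt' DA hMN hqN hf u hu hr hΔ) hDA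

/-- **E-desc-239 (typed candidate Prop): the DYADIC defect law from the `q`-expansion identity,
level-free, for root level `M` and `d = ±2`.**  A THEOREM for every complete `M` with `4 ∣ M` (below). -/
def TwoTwistCuspCoeffManinDvd (M : ℕ) [NeZero M] (d : ℤ) : Prop :=
  ∀ (A : WeierstrassCurve ℚ) [A.IsElliptic] [A.IsGloballyMinimal] (DA : ModularParametrizationData A M),
    (∀ z ∈ DA.L.lattice, ∃ w ∈ periodLattice DA.f, z = DA.c * w) →
    ∀ (C : WeierstrassCurve ℚ) [C.IsElliptic] [C.IsGloballyMinimal] (u : VariableChange ℚ) (r : ℤ),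
      u • A.quadraticTwist (d : ℚ) = C → (r : ℚ) ^ 12 * C.Δ = (d : ℚ) ^ 6 * A.Δ →
      ∀ (W' : WeierstrassCurve ℚ) [W'.IsElliptic] [W'.IsGloballyMinimal] (N : ℕ) [NeZero N]
        (D' : ModularParametrizationData W' N), 2 ^ 2 ∣ N → M ∣ 2 ^ 6 * N →
        (∀ n : ℕ, ¬ 2 ∣ n →
          cuspCoeff D'.f n = ((if d = 2 then ZMod.χ₈ n else ZMod.χ₈' n : ℤ) : ℂ) * cuspCoeff DA.f n) →
        (∀ z ∈ D'.L.lattice, ∃ w ∈ periodLattice D'.f, z = D'.c * w) → D'.maninConstant ∣ r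

/-- **E-desc-240 (typed candidate Prop): the ODD defect law from the `q`-expansion identity.** -/
def OddTwistCuspCoeffManinDvd (M q : ℕ) [NeZero M] [Fact q.Prime] : Prop :=
  ∀ (A : WeierstrassCurve ℚ) [A.IsElliptic] [A.IsGloballyMinimal] (DA : ModularParametrizationData A M),
    (∀ z ∈ DA.L.lattice, ∃ w ∈ periodLattice DA.f, z = DA.c * w) →
    ∀ (C : WeierstrassCurve ℚ) [C.IsElliptic] [C.IsGloballyMinimal] (u : VariableChange ℚ) (r : ℤ),
      u • A.quadraticTwist (((-1 : ℤ) ^ (q / 2) * q : ℤ) : ℚ) = C → r ≠ 0 →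
      (r : ℚ) ^ 12 * C.Δ = ((((-1 : ℤ) ^ (q / 2) * q : ℤ)) : ℚ) ^ 6 * A.Δ →
      ∀ (W' : WeierstrassCurve ℚ) [W'.IsElliptic] [W'.IsGloballyMinimal] (N : ℕ) [NeZero N]
        (D' : ModularParametrizationData W' N), M ∣ N → q ^ 2 ∣ N →
        (∀ n : ℕ, cuspCoeff D'.f n =
          (quadraticChar (ZMod q)).ringHomComp (Int.castRingHom ℂ) n * cuspCoeff DA.f n) →
        (∀ z ∈ D'.L.lattice, ∃ w ∈ periodLattice D'.f, z = D'.c * w) → D'.maninConstant ∣ r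

/-- `LevelManinOne M ∧ 4 ∣ M` ⟹ `TwoTwistCuspCoeffManinDvd M d` (coefficient-identity form of the dyadic defect law). [cite: Stevens1989, Lemma (5.4) p. 97] -/
theorem twoTwistCuspCoeffManinDvd_of_levelManinOne {M : ℕ} [NeZero M] (hM : LevelManinOne M)
    (h4M : 4 ∣ M) {d : ℤ} (hd : d = 2 ∨ d = -2) : TwoTwistCuspCoeffManinDvd M d :=
  fun A _ _ DA hoptA _C _ _ u _r hu hΔ _W' _ _ _N _ D' h4N hML hf hopt' ↦
    maninConstant_dvd_defect_of_twoTwist_cuspCoeff hd DA (hM A DA hoptA) h4M u hu hΔ D' h4N hML hf hopt'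

/-- `LevelManinOne M` ⟹ `OddTwistCuspCoeffManinDvd M q` for every odd prime `q` (coefficient-identity form of the odd defect law). [cite: Stevens1989, Lemma (5.2) p. 96] -/
theorem oddTwistCuspCoeffManinDvd_of_levelManinOne {M : ℕ} [NeZero M] (hM : LevelManinOne M)
    {q : ℕ} [Fact q.Prime] (hq2 : q ≠ 2) : OddTwistCuspCoeffManinDvd M q :=
  fun A _ _ DA hoptA _C _ _ u _r hu hr hΔ _W' _ _ _N _ D' hMN hqN hf hopt' ↦
    maninConstant_dvd_defect_of_oddTwist_cuspCoeff hq2 DA (hM A DA hoptA) u hu hr hΔ D' hMN hqN hf hopt'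

/-- **E-desc-239/240 as THEOREMS over the thirteen complete `4 ∣ M` levels / seventeen complete levels.** -/
theorem twistCuspCoeff_families {d : ℤ} (hd : d = 2 ∨ d = -2) {q : ℕ} [Fact q.Prime] (hq2 : q ≠ 2) :
    (TwoTwistCuspCoeffManinDvd 20 d ∧ TwoTwistCuspCoeffManinDvd 24 d ∧ TwoTwistCuspCoeffManinDvd 32 d ∧
      TwoTwistCuspCoeffManinDvd 36 d ∧ TwoTwistCuspCoeffManinDvd 40 d ∧ TwoTwistCuspCoeffManinDvd 44 d ∧
      TwoTwistCuspCoeffManinDvd 48 d ∧ TwoTwistCuspCoeffManinDvd 52 d ∧ TwoTwistCuspCoeffManinDvd 56 d ∧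
      TwoTwistCuspCoeffManinDvd 64 d ∧ TwoTwistCuspCoeffManinDvd 72 d ∧ TwoTwistCuspCoeffManinDvd 80 d ∧
      TwoTwistCuspCoeffManinDvd 108 d) ∧
    (OddTwistCuspCoeffManinDvd 20 q ∧ OddTwistCuspCoeffManinDvd 24 q ∧ OddTwistCuspCoeffManinDvd 27 q ∧
      OddTwistCuspCoeffManinDvd 32 q ∧ OddTwistCuspCoeffManinDvd 36 q ∧ OddTwistCuspCoeffManinDvd 40 q ∧
      OddTwistCuspCoeffManinDvd 44 q ∧ OddTwistCuspCoeffManinDvd 45 q ∧ OddTwistCuspCoeffManinDvd 48 q ∧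
      OddTwistCuspCoeffManinDvd 52 q ∧ OddTwistCuspCoeffManinDvd 54 q ∧ OddTwistCuspCoeffManinDvd 56 q ∧
      OddTwistCuspCoeffManinDvd 63 q ∧ OddTwistCuspCoeffManinDvd 64 q ∧ OddTwistCuspCoeffManinDvd 72 q ∧
      OddTwistCuspCoeffManinDvd 80 q ∧ OddTwistCuspCoeffManinDvd 108 q) :=
  ⟨⟨twoTwistCuspCoeffManinDvd_of_levelManinOne levelManinOne_twenty ⟨5, rfl⟩ hd,
    twoTwistCuspCoeffManinDvd_of_levelManinOne levelManinOne_twentyFour ⟨6, rfl⟩ hd,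
    twoTwistCuspCoeffManinDvd_of_levelManinOne levelManinOne_thirtyTwo ⟨8, rfl⟩ hd,
    twoTwistCuspCoeffManinDvd_of_levelManinOne levelManinOne_thirtySix ⟨9, rfl⟩ hd,
    twoTwistCuspCoeffManinDvd_of_levelManinOne levelManinOne_forty ⟨10, rfl⟩ hd,
    twoTwistCuspCoeffManinDvd_of_levelManinOne levelManinOne_fortyFour ⟨11, rfl⟩ hd,
    twoTwistCuspCoeffManinDvd_of_levelManinOne levelManinOne_fortyEight ⟨12, rfl⟩ hd,
    twoTwistCuspCoeffManinDvd_of_levelManinOne levelManinOne_fiftyTwo ⟨13, rfl⟩ hd,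
    twoTwistCuspCoeffManinDvd_of_levelManinOne levelManinOne_fiftySix ⟨14, rfl⟩ hd,
    twoTwistCuspCoeffManinDvd_of_levelManinOne levelManinOne_sixtyFour ⟨16, rfl⟩ hd,
    twoTwistCuspCoeffManinDvd_of_levelManinOne levelManinOne_seventyTwo ⟨18, rfl⟩ hd,
    twoTwistCuspCoeffManinDvd_of_levelManinOne levelManinOne_eighty ⟨20, rfl⟩ hd,
    twoTwistCuspCoeffManinDvd_of_levelManinOne levelManinOne_oneHundredEight ⟨27, rfl⟩ hd⟩,
   ⟨oddTwistCuspCoeffManinDvd_of_levelManinOne levelManinOne_twenty hq2,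
    oddTwistCuspCoeffManinDvd_of_levelManinOne levelManinOne_twentyFour hq2,
    oddTwistCuspCoeffManinDvd_of_levelManinOne levelManinOne_twentySeven hq2,
    oddTwistCuspCoeffManinDvd_of_levelManinOne levelManinOne_thirtyTwo hq2,
    oddTwistCuspCoeffManinDvd_of_levelManinOne levelManinOne_thirtySix hq2,
    oddTwistCuspCoeffManinDvd_of_levelManinOne levelManinOne_forty hq2,
    oddTwistCuspCoeffManinDvd_of_levelManinOne levelManinOne_fortyFour hq2,
    oddTwistCuspCoeffManinDvd_of_levelManinOne levelManinOne_fortyFive hq2,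
    oddTwistCuspCoeffManinDvd_of_levelManinOne levelManinOne_fortyEight hq2,
    oddTwistCuspCoeffManinDvd_of_levelManinOne levelManinOne_fiftyTwo hq2,
    oddTwistCuspCoeffManinDvd_of_levelManinOne levelManinOne_fiftyFour hq2,
    oddTwistCuspCoeffManinDvd_of_levelManinOne levelManinOne_fiftySix hq2,
    oddTwistCuspCoeffManinDvd_of_levelManinOne levelManinOne_sixtyThree hq2,
    oddTwistCuspCoeffManinDvd_of_levelManinOne levelManinOne_sixtyFour hq2,
    oddTwistCuspCoeffManinDvd_of_levelManinOne levelManinOne_seventyTwo hq2,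
    oddTwistCuspCoeffManinDvd_of_levelManinOne levelManinOne_eighty hq2,
    oddTwistCuspCoeffManinDvd_of_levelManinOne levelManinOne_oneHundredEight hq2⟩⟩



end Summit.BirchSwinnertonDyer.BirchSwinnertonDyer.Theorems.ManinLocalTwoThree.TwistDefect

end
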